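import Summits.QuantumFields.YangMills.Theses.UnitScaleTilt
import Literature.MathematicalPhysics.QuantumFieldTheory.Balaban1983to89.T3SplitLog
import Literature.MathematicalPhysics.QuantumFieldTheory.Balaban1983to89.T3UpperLiftSplitLog
import Literature.MathematicalPhysics.QuantumFieldTheory.Balaban1983to89.T3ExistSplit
import Summits.QuantumFields.YangMills.Theorems.UnitScaleTiltMinimiserStabilityRegPrAvgActionDefect
import Summits.QuantumFields.YangMills.Theorems.UnitScaleTiltMinimiserStabilityRegPrAvgCurvGrad
import Summits.QuantumFields.YangMills.Theorems.UnitScaleTiltMinimiserStabilityRegPrAttainmentOfLeaves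
import Summits.QuantumFields.YangMills.Theorems.UnitScaleTiltMinimiserStabilityRegPrSmoothLift
import Summits.QuantumFields.YangMills.Theorems.UnitScaleTiltMinimiserStabilityRegPrCritCurvGradLog
import Summits.QuantumFields.YangMills.Theorems.UnitScaleTiltMinimiserStabilityRegPrProp8Iter
import Summits.QuantumFields.YangMills.Theorems.UnitScaleTiltProp7PV3CDEAtSPrint
import HarnessLib

/-!
# LAYER-4 BIRTH v8 CANDIDATE of the K1 crux child «MinimiserStabilityRegPr» (stmt-QuantumFields-19200) = registered v7 (cc37a17877262141) WITH
# STUB V3 `stub_prop7From14` ([Balaban1985Variational] Prop. 7 from a background (14)) REPLACED BY THE FOUR NATIVE PRINT ROWS P-V3-A ∕ C ∕ D ∕ E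
# (OWNER RULING g24-№1 §A + AMENDMENT A2′, HOME route-R3/ym/plan-g24/OWNER-RULING-g24-1.md 5a0ee51d2ac617d3, OWNER-RULING-g24-1-A2prime.md d8b1e268a7e286bb)
# — penned by the route owner (ym3-torus-plan g24); registration by OPS on an R-request only; stubs {stub_halvingStep, stub_PV3A, stub_PV3C, stub_PV3D, stub_PV3E}.
#
# v8 CHANGE.  Print proves Prop. 7 (p. 299) from: Prop. 2 (the chart (16) of the space (18) by (19)–(21), = [Balaban1985RegularSpaces] Thm 2), Props 5–6
# («exactly one configuration critical in (19)–(21) near every (14)-background», Sects. C–E (43)–(140)), the p. 299 return from (19)–(21) to (18)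
# ([Balaban1985RegularSpaces] Prop. 7) and (141)–(142) (a critical configuration in (6)(e) minimises over (6)(e)).  The cell has typed the FIVE SECT. A–B
# LETTERS OF PRINT natively at the T³ carriers, based at the `k`-centre (w1 `Prop7SPrint`: `IsAxialPrint` (1.19), `RestrictedPrint` (1.29), `AvgCondPrint` (20),
# `IsLandauPrint` (21)∕(1.38), `CritLPrint`; presentation `sPrint L T`), the LOG-CHART Sect. C–E letters (w2 `Prop7TPrint.tPrintOf`: `Sol111` := «X Hermitian-
# traceless ∧ (20) ∧ (21) ∧ e^{iX} critical», `T112 := e^{iX}`, `nMax := nMax19`; at these letters Prop. 5 and the leaf `crit112` are THEOREMS,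
# `Prop7PV3CDELogChart.prop5Printed_logChart` ∕ `crit112_logChart`), and the KNIT `Prop7PV3CDELogChart.prop7From14At_of_natives_logChart`
# (V3 ⇐ A ∧ C ∧ D ∧ E at `tPrintFam A`, print's p. 296 ∕ p. 299 assembly with the Sect. A laws `Prop7AxialReprPrint.inj16_print_based` ∕
# `Prop7ChartPrint.axialRepr_print_based_uniform`; consumed here through `Prop7PV3CDEAtSPrint.prop7From14At_v8`, the composition at `S_v8 := tPrintFam (sPrint L T)`).  So V3 becomes four stubs, each ONE statement of print at the T³ objects:
#   A  `stub_PV3A`  — [Balaban1985RegularSpaces] THEOREM 2 for the based letters: `∃ B₁ c₁, Prop2Printed B₁ B₃ L³ c₁ (famLG3 L (sPrint L T))` (w1's A1 text);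
#   C  `stub_PV3C`  — [Balaban1985Variational] PROPS 5–6 NATIVELY, T-free: «∃ B₀ a₄, ∀ (14)-background, ∃! X, nMax19 X < ε₄ ∧ Herm ∧ (20) ∧ (21) ∧ e^{iX} critical ∧
#                     nMax19 X < 3B₀L³B₃ε₁» (≡ `∃ B₀, Prop6Printed B₀ B₃ L³ (famLG3 L (tPrintFam (sPrint L T)))`, `Prop7PV3CDELogChart.prop6Printed_logChart_iff`);
#   D  `stub_PV3D`  — the p. 299 RETURN TO (18) in print's regime `L³B₃ε₁ ≤ ε₂ ≤ c` ([Balaban1985RegularSpaces] Prop. 7; plaquette clause landed: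
#                     `Prop7B8Prop7Plaq.plaqSmall_gaugeAct_emb15_of_in19`), T-free (based letters by name);
#   E  `stub_PV3E`  — (141)–(142): an R2-critical `(U₁U₀)^u ∈ (6)(e)`, `e ≤ e₅`, minimises over (6)(e), T-free.
# `prop7From14_v8` discharges the v7 text of V3 VERBATIM from A∕C∕D∕E (no sorry of its own; the Sect. C–E tail `T` is immaterial — every field of
# `tPrintFam (sPrint L T)` is pinned — and is instantiated at a trivial tail); B₃ stays ONE existential per L fixed by `stub_halvingStep` and shared by A∕C∕D∕E∕V4′
# (unchanged compositions `landed_prop8`, `variational_of_leaves_log`, `MinimiserStabilityRegPr_of`).  The regime token `L³B₃ε₁ ≤ ε₂` of D is MANDATORY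
# (w2 LOCATED note, FILE A `Prop7PV3CDENative` §0: the unregimed leaf `ExistenceLeavesCap.axial18` is refutable at honest letters by `U₁ = 1, X = 0` over a
# curved R2-critical background, `T3SectALandauChart.in19_one_zero` + `regPr_gaugeAct_iff`).
# (v7 header kept below for the record.)
# was: LAYER-4 BIRTH v7 CANDIDATE … = registered v6 (636b1fa3b005b89b) WITH STUB V2 `stub_prop8` REPLACED BY THE ONE-STEP HALVING STUB `stub_halvingStep`
# (OWNER RULING g20-№2 (B)) and V4′ `stub_critCurvGradLog` LANDED (p511133).

WHY V4′ (HOME/UV3-NODE.md §21; evidence #36 on 19200): v5's V4 = `B11.SectFPrinted B₃ (famX L)` is EXACTLY the `β = β₀ = 1` clause of [Balaban1985Variational] (9)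
for critical configurations — print does not derive it ([Balaban1985RegularSpaces] Thm 2 (1.36) is `β₀ < 1`) and for the constrained minimiser it fails like
`(K − n)·log L`; every use tolerates a factor polynomial in `K − n` (`ε₁ = B₃·θBal(⌊K/m⌋)` decays geometrically), so V4′ is the log-Lipschitz statement
`CritCurvGradLogAt` (LANDED, p511133) and the compositions are the re-derived ones of `T3CurvGradLog` ∕ `T3SplitLog` ∕ `T3UpperLiftSplitLog`.

Stubs (sorries ONLY here) — v8: `stub_halvingStep` (V2′, verbatim v7), `stub_PV3A`, `stub_PV3C`, `stub_PV3D`, `stub_PV3E` (V3 rows, NEW).  Theorems with no sorry of their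
own: `landed_prop8` (V2 ⇐ V2′, `Prop8Iter`), `prop7From14_v8` (V3 ⇐ A∕C∕D∕E, `Prop7PV3CDELogChart`), `stub_critCurvGradLog` (V4′, p511133), `landed_smoothLift` (p466834),
`landed_avgCurvGrad` (p440643), `landed_avgActionDefect` (p437535), `variational_of_leaves_log`, and the composition `MinimiserStabilityRegPr_of`, which concludes
the route decl BY NAME.
-/

noncomputable section

open MeasureTheory Filter Topology
open scoped Matrix.Norms.L2Operator
open Literature.MathematicalPhysics.QuantumFieldTheory.Balaban1983to89
open Literature.MathematicalPhysics.QuantumFieldTheory.Balaban1983to89.T3ContinuumYM3Torus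
open Literature.MathematicalPhysics.QuantumFieldTheory.Balaban1983to89.T3UnitLawDensityEML (ℰp measurableE_ℰp)
open Literature.MathematicalPhysics.QuantumFieldTheory.Balaban1983to89.T3UnitScaleTilt
open Literature.MathematicalPhysics.QuantumFieldTheory.Balaban1983to89.T3TiltDescent
open Literature.MathematicalPhysics.QuantumFieldTheory.Balaban1983to89.T3CruxEstimates
open Literature.MathematicalPhysics.QuantumFieldTheory.Balaban1983to89.T3ConstrainedMinimiser
open Literature.MathematicalPhysics.QuantumFieldTheory.Balaban1983to89.T3DescentFibreTower
open Literature.MathematicalPhysics.QuantumFieldTheory.Balaban1983to89.T3MinimiserStabilityReduction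
open Literature.MathematicalPhysics.QuantumFieldTheory.Balaban1983to89.T3RegularMinimiser
open Literature.MathematicalPhysics.QuantumFieldTheory.Balaban1983to89.T3PrintedRegularMinimiser
open Literature.MathematicalPhysics.QuantumFieldTheory.Balaban1983to89.T3PrintedRegularMinimiserReduction
open Literature.MathematicalPhysics.QuantumFieldTheory.Balaban1983to89.T3PrintedMinimiserExistence
open Literature.MathematicalPhysics.QuantumFieldTheory.Balaban1983to89.T3LowerAlongMinimisersSplit
open Literature.MathematicalPhysics.QuantumFieldTheory.Balaban1983to89.T3AvgDivergenceSplit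
open Literature.MathematicalPhysics.QuantumFieldTheory.Balaban1983to89.T3UpperAlongMinimisersSplit
open Literature.MathematicalPhysics.QuantumFieldTheory.Balaban1983to89.T3UpperLiftSplit
open Literature.MathematicalPhysics.QuantumFieldTheory.Balaban1983to89.T3LowerActionSplit
open Literature.MathematicalPhysics.QuantumFieldTheory.Balaban1983to89.T3ExistSplit
open Literature.MathematicalPhysics.QuantumFieldTheory.Balaban1983to89.T3Thm1Carrier
open Literature.MathematicalPhysics.QuantumFieldTheory.Balaban1983to89.T3CurvGradLog
open Literature.MathematicalPhysics.QuantumFieldTheory.Balaban1983to89.T3SplitLog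
open Literature.MathematicalPhysics.QuantumFieldTheory.Balaban1983to89.T3UpperLiftSplitLog
open Literature.MathematicalPhysics.QuantumFieldTheory.Balaban1983to89.B11 (Prop8Printed)
open Literature.MathematicalPhysics.QuantumFieldTheory.Balaban1983to89.T3Thm1CarrierNative (IsCritR2 Prop7From14At)
open Literature.MathematicalPhysics.QuantumFieldTheory.Balaban1983to89.T3SectALandauChart (ResidFam famLG3 In19 CloseAvg emb15)
open Literature.MathematicalPhysics.QuantumFieldTheory.Balaban1983to89.B11 (Prop2Printed Prop6Printed)
open Summit.QuantumFields.YangMills.Theorems.Prop7TPrint (tPrintFam nMax19 expHermField)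
open Summit.QuantumFields.YangMills.Theorems.Prop7SPrint (sPrint IsAxialPrint RestrictedPrint AvgCondPrint IsLandauPrint CritLPrint)

namespace Summit.QuantumFields.YangMills.Cruxes.MinimiserStabilityRegPr.BirthV8

/-! ## §1 Registered stubs (each a genuine lemma of the line; sorries live ONLY here) -/

/-- STUB V2′ — THE ONE-STEP HALVING of [Balaban1985Variational] Sect. F at the d = 3 carriers (p. 304, verbatim: «hence U_k belongs to the space (2) with
max{B₃ε₁, ½ε₀} instead of ε₀»; Sect. F p. 300: «We will use only the fact that they are critical configurations of the functional (5) and that they belong to the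
spaces (6) with ε₀ sufficiently small»), for SOME B₃ > 4 and a₅ > 0: `Prop8Printed`'s binders with the conclusion HALVED — for every member `i` (block size `L`,
heights `n < K`), `0 < ε₁`, every (7)-datum `V`, every `U ∈ 𝔘_k(ε₀) ∩ 𝔅_k(V)` critical in reading R2, `ε₀ ≤ a₅` ⇒ `U ∈ 𝔘_k(max{B₃ε₁, ½ε₀})` (OWNER RULING g20-№2 (B1)).
Equivalent readings (p1 g14 `Prop8Iter.halvingLiteral_iff_halvingStep` / `…_iff_native`): `∀ i, B11Prop8Assembly.HalvingStep (famX L i) B₃ a₅`,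
`T3Thm1CarrierNative.HalvingNativeAt L a₅ B₃`; reducible to MINIMISERS over (6)(ε₀), `0 < ε₀ ≤ a₅` (`Prop8Iter.halvingLiteral_of_minimisers`).
Content (work map, owner (B3)): [Balaban1985RegularSpaces] Thm 2 gauge (152), the flat constrained propagators of [Balaban1984PropagatorsII] (2.47)–(2.51) (162)–(164),
the datum bound (160), smallness (165)–(168). XL. [cite: Balaban1985Variational, Sect. F p.304 before Prop. 8] -/
theorem stub_halvingStep : ∀ (L : ℕ), 1 < L → ∃ B₃ : ℝ, 4 < B₃ ∧ ∃ a₅ : ℝ, 0 < a₅ ∧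
    ∀ (i : Idx L) (ε₀ ε₁ : ℝ), 0 < ε₁ → ∀ (V : (famX L i).Bdry) (U : (famX L i).Cfg), (famX L i).Reg7 ε₁ V → (famX L i).InU ε₀ U →
      (famX L i).InB V U → (famX L i).IsCritical V U → ε₀ ≤ a₅ → (famX L i).InU (max (B₃ * ε₁) (ε₀ / 2)) U := by
  sorry

/-- STUB P-V3-A — [Balaban1985RegularSpaces] THEOREM 2 (the chart of `𝔅_k(V) ∩ Ax_k(U₀)` by the small fields of (19)–(21), «we can take β₀, α₁ arbitrary
positive numbers and then there exists B₁ such that the above theorem holds» p. 83) READ AS [Balaban1985Variational] PROP. 2 at the T³ carriers of block size `L`,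
for PRINT'S BASED LETTERS (w1 `Prop7SPrint.sPrint`: (1.19) `IsAxialPrint`, (1.29) `RestrictedPrint`, (20) `AvgCondPrint`, (21) `IsLandauPrint`, `CritLPrint`; the
Sect. C–E tail `T` is NOT read by Prop. 2: `Prop2Printed … (famLG3 L (tPrintFam A)) ↔ Prop2Printed … (famLG3 L A)` is `Iff.rfl`, w2 `Prop7PV3CDEAtSPrint.prop2Printed_tPrintFam_iff`):
for every B₃ > 4 SOME `B₁, c₁ > 0` with `B11.Prop2Printed B₁ B₃ L³ c₁ (famLG3 L (sPrint L T))` — w1's A1 text VERBATIM (OWNER RULING g24-№1 §A).  Native unfolding: `T3SectALandauChart.prop2Printed_famLG3_iff_native`.  Content: [6] Thm 2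
on `ℤᵈ` (typed: `B8Thm2TorusAt`, `B8Eq131Derivation`) transported to the torus through the based periodic pullback (`B10Eq27TorusAxialLog.pull`); injectivity of
(16) is LANDED (`Prop7AxialReprPrint.inj16_print_based`). L∕XL. Why it might fail: only by a letter mismatch between the based torus readings and [6]'s `ℤᵈ`
statement (the `u`-free form (1.31) vs the defining form (1.28)–(1.30) of (20)). [cite: Balaban1985RegularSpaces, Thm 2 p.83, (1.28)-(1.31) pp.81-82;
Balaban1985Variational, Prop. 2 p.281] -/
theorem stub_PV3A : ∀ (L : ℕ), 1 < L → ∀ (T : ResidFam L) (B₃ : ℝ), 4 < B₃ →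
    ∃ B₁ c₁ : ℝ, 0 < B₁ ∧ 0 < c₁ ∧ Prop2Printed B₁ B₃ ((L : ℝ) ^ 3) c₁ (famLG3 L (sPrint L T)) := by
  sorry

/-- STUB P-V3-C — [Balaban1985Variational] PROPOSITIONS 5–6 IN THE LOG CHART («there exists exactly one solution of (111) in the space (43)», p. 296; (123)–(140)):
in the NATIVE T³ form (w2's pick, T-free and Sect. C–E-letter-free; ≡ `∃ B₀, B11.Prop6Printed B₀ B₃ L³ (famLG3 L (tPrintFam (sPrint L T)))` by w2
`Prop7PV3CDELogChart.prop6Printed_logChart_iff`): for every B₃ > 4 SOME `B₀ > 0` with «∃ a₄ > 0, ∀ member, ∀ 0 < ε₁, ∀ ε₄ ≤ a₄ with 2B₀L³B₃ε₁ ≤ ε₄, ∀ (14)-background `(V, U₀)`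
(`RegPr (L³B₃ε₁) U₀ ∧ CloseAvg (L³ε₁) V U₀`), ∃! X with `nMax19 U₀ X < ε₄`, X Hermitian-traceless, (20) `AvgCondPrint V U₀ X`, (21) `IsLandauPrint U₀ X`, `e^{iX}`
critical (`CritLPrint V U₀ (expHermField X)`), and `nMax19 U₀ X < 3B₀L³B₃ε₁`».  Content: Sects. C–E of print — the operators `H(U₀)`, `D`,
`𝔊(U₀) = (H + D*D)⁻¹`, `H₁(U₀)` at a curved (14)-background on the torus ((43)–(115); `ℤᵈ`∕generic-level pieces typed in `B11Prop3*`–`B11Prop6*`, `B7Prop4GeneralLevels`),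
the contraction (116)–(121) and analyticity (135)–(140).  XL (the largest row). Why it might fail: uniqueness is claimed in the ball `nMax19 < ε₄` of the LOG chart,
where print's (43) is a ball for `A′ = η⁻¹X` in the norm (42) — a norm mismatch at the boundary of the chart would break «exactly one». [cite: Balaban1985Variational,
Prop. 5 p.294, Prop. 6 p.296, (43) p.285, (111)-(121) pp.294-296, (123)-(140) pp.296-299] -/
theorem stub_PV3C : ∀ (L : ℕ), 1 < L → ∀ (B₃ : ℝ), 4 < B₃ →
    ∃ B₀ a₄ : ℝ, 0 < B₀ ∧ 0 < a₄ ∧ ∀ (i : Idx L) (ε₁ ε₄ : ℝ), 0 < ε₁ → ε₄ ≤ a₄ → 2 * B₀ * (L : ℝ) ^ 3 * B₃ * ε₁ ≤ ε₄ →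
      ∀ (V : GaugeField (i.1.1.P i.1.2.1) 0 (Matrix.specialUnitaryGroup (Fin 2) ℂ))
        (U₀ : GaugeField (i.1.1.P i.1.2.2) 0 (Matrix.specialUnitaryGroup (Fin 2) ℂ)),
        RegPr i.1.1 i.1.2.1 i.1.2.2 ((L : ℝ) ^ 3 * B₃ * ε₁) U₀ → CloseAvg i.1.1 i.1.2.1 i.1.2.2 i.2.2.le ((L : ℝ) ^ 3 * ε₁) V U₀ →
        ∃ X : PBond (i.1.1.P i.1.2.2) 0 → Matrix (Fin 2) (Fin 2) ℂ,
          nMax19 i.1.1 i.1.2.1 i.1.2.2 U₀ X < ε₄ ∧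
          ((∀ b : PBond (i.1.1.P i.1.2.2) 0, (X b).IsHermitian ∧ Matrix.trace (X b) = 0) ∧ AvgCondPrint i.1.1 i.1.2.1 i.1.2.2 i.2.2.le V U₀ X ∧
            IsLandauPrint i.1.1 i.1.2.1 i.1.2.2 U₀ X ∧ CritLPrint i.1.1 i.1.2.1 i.1.2.2 i.2.2.le V U₀ (expHermField X)) ∧
          nMax19 i.1.1 i.1.2.1 i.1.2.2 U₀ X < 3 * B₀ * (L : ℝ) ^ 3 * B₃ * ε₁ ∧
          ∀ X' : PBond (i.1.1.P i.1.2.2) 0 → Matrix (Fin 2) (Fin 2) ℂ, nMax19 i.1.1 i.1.2.1 i.1.2.2 U₀ X' < ε₄ →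
            ((∀ b : PBond (i.1.1.P i.1.2.2) 0, (X' b).IsHermitian ∧ Matrix.trace (X' b) = 0) ∧ AvgCondPrint i.1.1 i.1.2.1 i.1.2.2 i.2.2.le V U₀ X' ∧
              IsLandauPrint i.1.1 i.1.2.1 i.1.2.2 U₀ X' ∧ CritLPrint i.1.1 i.1.2.1 i.1.2.2 i.2.2.le V U₀ (expHermField X')) → X' = X := by
  sorry

/-- STUB P-V3-D — THE p. 299 RETURN FROM (19)–(21) TO (18) IN PRINT'S REGIME `L³B₃ε₁ ≤ ε₂ ≤ c` ([Balaban1985Variational] p. 299 «this configuration determines the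
configuration U′U₀ belonging to the space (18) with O(1)B₃ε₁ instead of ε₀»; [Balaban1985RegularSpaces] Prop. 7 (1.144) p. 100), at the T³ carriers with the based letters:
SOME `O₂ ≥ 1`, `c > 0` such that for every member, every `ε₁, ε₂` with `L³B₃ε₁ ≤ ε₂ ≤ c`, every (14)-background `(V, U₀)`, every `U₁ = e^{iX}` in (19) at `ε₂`
(`In19 ε₂ U₀ U₁ X`) satisfying (20) `AvgCondPrint V U₀ X`, (21) `IsLandauPrint U₀ X` and «critical in (19)–(21)» `CritLPrint V U₀ U₁`, there is a (1.29)-restricted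
`u` (`RestrictedPrint U₀ u`) with `(U₁U₀)^u ∈ 𝔘_k(O₂ε₂)` (`RegPr (O₂ε₂)`), `(U₁U₀)^u ∈ 𝔅_k(V)` (`fibre`) and `(U₁U₀)^u` critical in reading R2 (`IsCritR2`).
T-free.  The witness `u` is `CritLPrint`'s; the fibre and R2 clauses come with it; the CONTENT is the quantitative regularity `RegPr (O₂ε₂) ((U₁U₀)^u)`: plaquette
clause LANDED (w2 `Prop7B8Prop7Plaq.plaqSmall_gaugeAct_emb15_of_in19`, [Balaban1985RegularSpaces] (1.47)), gauge invariance `regPr_gaugeAct_iff`, leaving the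
small-divergence clause of (2) from (19)'s covariant-derivative members.  M∕L. Why it might fail: the divergence clause of `RegPr` is STRICT and of first order in
`∂(U₁U₀)`; (19) at `ε₂` must control `D*_{U₁U₀}` of the composite field with a constant uniform in the member — if only `O(ε₂·(K−n))` holds the row needs the
log-tolerant reading. The regime token is mandatory (unregimed = refutable, FILE A §0). [cite: Balaban1985Variational, p.299 after (140), (18)-(19) p.280;
Balaban1985RegularSpaces, Prop. 7 (1.144) p.100, (1.47) p.84] -/
theorem stub_PV3D : ∀ (L : ℕ), 1 < L → ∀ (B₃ : ℝ), 4 < B₃ →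
    ∃ O₂ c : ℝ, 1 ≤ O₂ ∧ 0 < c ∧ ∀ (i : Idx L) (ε₁ ε₂ : ℝ) (V : GaugeField (i.1.1.P i.1.2.1) 0 (Matrix.specialUnitaryGroup (Fin 2) ℂ))
      (U₀ U₁ : GaugeField (i.1.1.P i.1.2.2) 0 (Matrix.specialUnitaryGroup (Fin 2) ℂ)) (X : PBond (i.1.1.P i.1.2.2) 0 → Matrix (Fin 2) (Fin 2) ℂ),
      (L : ℝ) ^ 3 * B₃ * ε₁ ≤ ε₂ → ε₂ ≤ c → RegPr i.1.1 i.1.2.1 i.1.2.2 ((L : ℝ) ^ 3 * B₃ * ε₁) U₀ → CloseAvg i.1.1 i.1.2.1 i.1.2.2 i.2.2.le ((L : ℝ) ^ 3 * ε₁) V U₀ →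
      In19 i.1.1 i.1.2.1 i.1.2.2 ε₂ U₀ U₁ X → AvgCondPrint i.1.1 i.1.2.1 i.1.2.2 i.2.2.le V U₀ X → IsLandauPrint i.1.1 i.1.2.1 i.1.2.2 U₀ X →
      CritLPrint i.1.1 i.1.2.1 i.1.2.2 i.2.2.le V U₀ U₁ →
        ∃ u : GaugeTransf (i.1.1.P i.1.2.2) 0 (Matrix.specialUnitaryGroup (Fin 2) ℂ), RestrictedPrint i.1.1 i.1.2.1 i.1.2.2 U₀ u ∧
          RegPr i.1.1 i.1.2.1 i.1.2.2 (O₂ * ε₂) (GaugeField.gaugeAct u (emb15 U₀ U₁)) ∧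
          GaugeField.gaugeAct u (emb15 U₀ U₁) ∈ fibre i.1.1 ℰp i.1.2.1 i.1.2.2 i.2.2.le V ∧
          IsCritR2 i.1.1 i.1.2.1 i.1.2.2 i.2.2.le V (GaugeField.gaugeAct u (emb15 U₀ U₁)) := by
  sorry

/-- STUB P-V3-E — [Balaban1985Variational] (141)–(142) («the configuration U′U₀ is a minimum of the functional (5) on the space (6) … A(U) − A(U′U₀) ≥ …», p. 299) at
the T³ carriers: SOME `e₅ > 0` such that for every member, every `e ≤ e₅`, every (14)-background `(V, U₀)`, every «critical in (19)–(21)» `U₁` (`CritLPrint V U₀ U₁`)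
and every (1.29)-restricted `u` with `W := (U₁U₀)^u ∈ 𝔘_k(e) ∩ 𝔅_k(V)` critical in reading R2 (`IsCritR2 V W`: a minimiser over print's regular fibre (6)(e′) for
SOME e′ > 0), `W ∈ (6)(e)` and `W` MINIMISES the Wilson action over (6)(e) (`IsMinOn wilsonAction4 (regFibrePr e V) W`).  T-free.  Content: for `e′ ≥ e` immediate
(monotonicity of (6)); for `e′ < e` it is the coercivity (142) of the action around the critical point on the whole regular fibre (6)(e), `e ≤ e₅` small so that
[Balaban1985RegularSpaces] Thm 2's chart covers (6)(e).  L. Why it might fail: (142) is proved in print inside ONE chart (18) around `U₀`; covering all of (6)(e) by such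
charts with a uniform `e₅` uses (152)∕Thm 2 again — a chart-covering gap would leave minimality only local. [cite: Balaban1985Variational, (141)-(142) p.299, (4)-(6)
p.278; Balaban1985RegularSpaces, Thm 2 p.83] -/
theorem stub_PV3E : ∀ (L : ℕ), 1 < L → ∀ (B₃ : ℝ), 4 < B₃ →
    ∃ e₅ : ℝ, 0 < e₅ ∧ ∀ (i : Idx L) (e ε₁ : ℝ) (V : GaugeField (i.1.1.P i.1.2.1) 0 (Matrix.specialUnitaryGroup (Fin 2) ℂ))
      (U₀ U₁ : GaugeField (i.1.1.P i.1.2.2) 0 (Matrix.specialUnitaryGroup (Fin 2) ℂ)) (u : GaugeTransf (i.1.1.P i.1.2.2) 0 (Matrix.specialUnitaryGroup (Fin 2) ℂ)),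
      e ≤ e₅ → RegPr i.1.1 i.1.2.1 i.1.2.2 ((L : ℝ) ^ 3 * B₃ * ε₁) U₀ → CloseAvg i.1.1 i.1.2.1 i.1.2.2 i.2.2.le ((L : ℝ) ^ 3 * ε₁) V U₀ →
      CritLPrint i.1.1 i.1.2.1 i.1.2.2 i.2.2.le V U₀ U₁ → RestrictedPrint i.1.1 i.1.2.1 i.1.2.2 U₀ u →
      RegPr i.1.1 i.1.2.1 i.1.2.2 e (GaugeField.gaugeAct u (emb15 U₀ U₁)) →
      GaugeField.gaugeAct u (emb15 U₀ U₁) ∈ fibre i.1.1 ℰp i.1.2.1 i.1.2.2 i.2.2.le V →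
      IsCritR2 i.1.1 i.1.2.1 i.1.2.2 i.2.2.le V (GaugeField.gaugeAct u (emb15 U₀ U₁)) →
        GaugeField.gaugeAct u (emb15 U₀ U₁) ∈ regFibrePr i.1.1 i.1.2.1 i.1.2.2 i.2.2.le e V ∧
        IsMinOn (fun W : GaugeField (i.1.1.P i.1.2.2) 0 (Matrix.specialUnitaryGroup (Fin 2) ℂ) => wilsonAction4 W)
          (regFibrePr i.1.1 i.1.2.1 i.1.2.2 i.2.2.le e V) (GaugeField.gaugeAct u (emb15 U₀ U₁)) := by
  sorry

/-- LANDED V2 (the v6 text of `stub_prop8`, now a theorem modulo V2′) — [Balaban1985Variational] PROPOSITION 8 at the d = 3 carriers for the SAME B₃ > 4, by the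
kernel-checked halving iteration: p1 g14's `Summit.QuantumFields.YangMills.Theorems.Prop8Iter.prop8_of_halvingLiteral` over lit-balaban's
`B11Prop8Assembly.prop8Printed_of_halvingStep` («We continue this way until we reach the bound B₃ε₁»). [cite: Balaban1985Variational, Prop. 8 p.304] -/
theorem landed_prop8 : ∀ (L : ℕ), 1 < L → ∃ B₃ : ℝ, 4 < B₃ ∧ Prop8Printed B₃ (famX L) :=
  Summit.QuantumFields.YangMills.Theorems.Prop8Iter.prop8_of_halvingLiteral stub_halvingStep

/-- LANDED-SHAPE V3 (the v7 text of `stub_prop7From14`, now a theorem modulo A ∕ C ∕ D ∕ E) — [Balaban1985Variational] PROPOSITION 7 FROM A BACKGROUND (14) at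
the d = 3 carriers for every B₃ > 4, by w2's knit `Prop7PV3CDEAtSPrint.prop7From14At_v8` (p585786; = `Prop7PV3CDELogChart.prop7From14At_of_natives_logChart` at `A := sPrint L T₀` with w1's
`hSax_sPrint`∕`hSre_sPrint`, (A) transported by `prop2Printed_tPrintFam_iff`, (C) converted by `prop6Printed_logChart_iff`); the Sect. C–E tail `T₀` is immaterial
(`tPrintFam (sPrint L T) = tPrintFam (sPrint L T')` is `rfl`) and is taken trivial. [cite: Balaban1985Variational, Prop. 7 p.299, p.296 (122), p.299 (141)-(142)] -/
theorem prop7From14_v8 : ∀ (L : ℕ), 1 < L → ∀ B₃ : ℝ, 4 < B₃ →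
    ∃ a₀ a₁' O₁ : ℝ, 0 < a₀ ∧ 0 < a₁' ∧ 1 ≤ O₁ ∧ ∀ (i : Idx L) (ε₀ ε₁ : ℝ), 0 < ε₁ → ∀ V : (famX L i).Bdry, (famX L i).Reg7 ε₁ V →
      ∀ U₀ : (famX L i).Cfg, (famX L i).InU ((L : ℝ) ^ 3 * B₃ * ε₁) U₀ → (famX L i).InB V U₀ →
        (ε₀ ≤ a₀ → B₃ * ε₁ ≤ ε₀ → (famX L i).AtMostOneCriticalOrbit ε₀ V) ∧
        (ε₁ ≤ a₁' → ∃ U : (famX L i).Cfg, (famX L i).OnMinimalOrbit (O₁ * (L : ℝ) ^ 3 * B₃ * ε₁) V U) := by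
  intro L hL B₃ hB₃
  -- a Sect. C–E tail: every field is overwritten by `sPrintAt` (Sect. A–B) and `tPrintOf` (Sect. C–E), so any tail gives print's presentation
  let T₀ : ResidFam L := fun i =>
    { IsAxial := fun _ _ => True, Restricted := fun _ _ => True, AvgCond := fun _ _ _ => True, IsLandau := fun _ _ => True,
      CritL := fun _ _ _ => True, In43 := fun _ _ _ => True, nM1 := fun _ _ => 0, Def47 := fun _ _ => True, T47 := fun _ X => X,
      normD := fun _ _ => 0, kerD := fun _ _ _ _ => 0, nMax := fun _ _ => 0, dVn := fun _ _ => 0, dVAnalytic := fun _ _ => True,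
      Sol111 := fun _ _ _ => True, T112 := fun _ U₀ _ => U₀, LikeH1B := fun _ _ _ => True, Sol111G := fun _ _ _ => True,
      SolAnalytic := fun _ _ _ => True }
  have hB₃1 : (1 : ℝ) ≤ B₃ := by linarith
  exact Summit.QuantumFields.YangMills.Theorems.Prop7PV3CDEAtSPrint.prop7From14At_v8 hL T₀ hB₃1
    (stub_PV3A L hL T₀ B₃ hB₃) (stub_PV3C L hL B₃ hB₃) (stub_PV3D L hL B₃ hB₃) (stub_PV3E L hL B₃ hB₃)

/-- LANDED V4′ — the log-Lipschitz curvature gradient of critical configurations in (8), p1 g13's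
`Summit.QuantumFields.YangMills.Theorems.CritCurvGradLog.stub_critCurvGradLog` (p511133; proved for EVERY (8)-regular configuration, `regPr_curvGrad_lt`;
cell memo HOME/UV3-NODE.md §22). [cite: Balaban1985Variational, Thm 1 (9) p.279; Balaban1985RegularSpaces, Thm 2 (1.36) p.82] -/
theorem stub_critCurvGradLog : ∀ (L : ℕ), 1 < L → ∀ B₃ : ℝ, 4 < B₃ → ∃ a₁ B₄ : ℝ, 0 < a₁ ∧ 0 < B₄ ∧ CritCurvGradLogAt L a₁ B₃ B₄ :=
  Summit.QuantumFields.YangMills.Theorems.CritCurvGradLog.stub_critCurvGradLog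

/-! ## §2 Landed inputs, by name -/

/-- LANDED — located gap G-K1a-2′ (smooth exact one-step lift), v4's `stub_smoothLift`, p466834. [cite: King1986, (A.5) p.676] -/
theorem landed_smoothLift : ∀ (L : ℕ), ∃ C₁ C₂ c : ℝ, 0 < C₁ ∧ 0 ≤ C₂ ∧ 0 < c ∧ SmoothLiftAt L C₁ C₂ c :=
  Summit.QuantumFields.YangMills.Theorems.SmoothLift.stub_smoothLift

/-- LANDED — located gap G-K1a-3a′ (first-order regularity of the one-step average), p440643. [cite: Balaban1985Averaging, Prop. 3 (122)-(123) p.36] -/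
theorem landed_avgCurvGrad : ∀ (L : ℕ), ∃ C₁ C₂ c : ℝ, 0 ≤ C₁ ∧ 0 < C₂ ∧ 0 < c ∧ AvgCurvGradAt L C₁ C₂ c :=
  Summit.QuantumFields.YangMills.Theorems.AvgCurvGrad.stub_avgCurvGrad

/-- LANDED — located gap G-K1a-3b′ (per-configuration averaging action defect), p437535. [cite: Federbush1987PhaseCellIII, Thm 4.3 (4.5) p.299] -/
theorem landed_avgActionDefect : ∀ (L : ℕ), ∃ C₂ c : ℝ, 0 ≤ C₂ ∧ 0 < c ∧ AvgActionDefectAt L C₂ c :=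
  Summit.QuantumFields.YangMills.Theorems.AvgActionDefect.stub_avgActionDefect

/-- **THE VARIATIONAL DATA FROM THE THREE LEAVES** (no sorry of its own): attainment over (6) from V3 ∧ V2 (p478378 `minSixAttainedAt_of_prop7_prop8`),
`MinimisersIn8At` from V2 (p428575 `minimisersIn8At_of_prop8`), and the log-Lipschitz minimiser schema from V4′ ∧ V2 (`minimiserCurvGradLogAt_of_crit`).
[cite: Balaban1985Variational, Thm 1 p.279, Prop 7 p.299, Prop 8 p.304] -/
theorem variational_of_leaves_log (L : ℕ) (hL : 1 < L) :
    ∃ â₀ â₁ a₀ a₁ B₃ B₄ : ℝ, 0 < â₀ ∧ 0 < â₁ ∧ 0 < a₀ ∧ 0 < a₁ ∧ 0 < B₃ ∧ 0 < B₄ ∧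
      MinSixAttainedAt L â₀ â₁ B₃ ∧ MinimisersIn8At L a₀ a₁ B₃ ∧ MinimiserCurvGradLogAt L a₀ a₁ B₃ B₄ := by
  obtain ⟨B₃, hB₃, h8⟩ := landed_prop8 L hL
  have h7 := prop7From14_v8 L hL B₃ hB₃
  obtain ⟨a₁, B₄, ha₁, hB₄, hc⟩ := stub_critCurvGradLog L hL B₃ hB₃
  have hB₃0 : 0 < B₃ := by linarith
  obtain ⟨â₀, â₁, hâ₀, hâ₁, hatt⟩ := Summit.QuantumFields.YangMills.Theorems.Variational.minSixAttainedAt_of_prop7_prop8 hL hB₃ h7 h8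
  obtain ⟨a₅, ha₅, h8'⟩ := minimisersIn8At_of_prop8 hB₃0 h8
  exact ⟨â₀, â₁, a₅, a₁, B₃, B₄, hâ₀, hâ₁, ha₅, ha₁, hB₃0, hB₄, hatt, h8' a₁, minimiserCurvGradLogAt_of_crit hB₃0 hc (h8' a₁)⟩

/-! ## §3 The composition — concludes the ROUTE DECL by name, no sorry of its own -/

/-- **`MinimiserStabilityRegPr ⇐ (stub_halvingStep ∧ stub_PV3A ∧ stub_PV3C ∧ stub_PV3D ∧ stub_PV3E) ∧ landed V4′ `stub_critCurvGradLog` ∧ landed_prop8 (iteration) ∧ landed_smoothLift ∧ landed_avgCurvGrad ∧ landed_avgActionDefect`**: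
EXIST by `T3ExistSplit.hasRegMinimisersPrAt_of_attained`, UPPER by `T3UpperLiftSplitLog.upperAlongRegPrMinimisersAt_of_splitLog'`, LOWER by
`T3SplitLog.lowerAlongRegPrMinimisersAt_of_splitLog'''` (both through the log-Lipschitz schema with K-dependent windows), then
`minimiserStabilityRegPrAt_of_alongRegPrMinimisers`; ε₁ := min of three, m₀ := 10, γ₁ := min of three; `p₀ > 2 > 0`; `L ≤ 1` is vacuous. -/
theorem MinimiserStabilityRegPr_of : Summit.QuantumFields.YangMills.Theses.UnitScaleTilt.MinimiserStabilityRegPr := by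
  intro L
  by_cases hL : 1 < L
  · obtain ⟨â₀, â₁, a₀, a₁, B₃, B₄, hâ₀, hâ₁, ha₀, ha₁, hB₃, hB₄, hatt, hIn8, hgrad⟩ := variational_of_leaves_log L hL
    -- EXIST
    obtain ⟨e₁, he₁, hE⟩ := hasRegMinimisersPrAt_of_attained hâ₀ hâ₁ hB₃ hatt
    -- UPPER
    obtain ⟨C₁, C₂, c, hC₁, hC₂, hc, hlift⟩ := landed_smoothLift L
    obtain ⟨e₂, he₂, hU⟩ := upperAlongRegPrMinimisersAt_of_splitLog' ha₀ ha₁ hB₃ hB₄ hC₁ hC₂ hc hIn8 hgrad hlift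
    -- LOWER
    obtain ⟨D₁, D₂, d, hD₁, hD₂, hd, havg⟩ := landed_avgCurvGrad L
    obtain ⟨E₂, e, hE₂, he, hdef⟩ := landed_avgActionDefect L
    obtain ⟨e₃, he₃, hLo⟩ := lowerAlongRegPrMinimisersAt_of_splitLog''' hL.le ha₀ ha₁ hB₃ hB₄ hD₂ hd hE₂ he hIn8 hgrad havg hdef
    -- the common `ε₁`, `m₀ = 10`, `γ₁`
    refine ⟨min e₁ (min e₂ e₃), lt_min he₁ (lt_min he₂ he₃), fun ε₀ hε hεle => ⟨10, fun m hm b₀ p₀ hb hp => ?_⟩⟩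
    have hε₁ : ε₀ ≤ e₁ := hεle.trans (min_le_left _ _)
    have hε₂ : ε₀ ≤ e₂ := hεle.trans ((min_le_right _ _).trans (min_le_left _ _))
    have hε₃ : ε₀ ≤ e₃ := hεle.trans ((min_le_right _ _).trans (min_le_right _ _))
    have hm2 : 2 ≤ m := le_trans (by norm_num) hm
    have hp0 : 0 < p₀ := lt_trans two_pos hp
    obtain ⟨γa, hγa, hA⟩ := hE ε₀ hε hε₁ m hm2 b₀ p₀ hb
    obtain ⟨γb, hγb, hB⟩ := hU ε₀ hε hε₂ m hm b₀ p₀ hb hp0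
    obtain ⟨γc, hγc, hC⟩ := hLo ε₀ hε hε₃ m hm b₀ p₀ hb hp0
    refine ⟨min γa (min γb γc), lt_min hγa (lt_min hγb hγc), fun F γ hFL hγ hγle => ?_⟩
    have hγa' : γ ≤ γa := hγle.trans (min_le_left _ _)
    have hγb' : γ ≤ γb := hγle.trans ((min_le_right _ _).trans (min_le_left _ _))
    have hγc' : γ ≤ γc := hγle.trans ((min_le_right _ _).trans (min_le_right _ _))
    exact minimiserStabilityRegPrAt_of_alongRegPrMinimisers hγ.le (hA F γ hFL hγ hγa') (hB F γ hFL hγ hγb') (hC F γ hFL hγ hγc')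
  · -- no member of the family has block size `L ≤ 1`
    exact ⟨1, one_pos, fun ε₀ _ _ => ⟨0, fun m _ b₀ p₀ _ _ => ⟨1, one_pos, fun F γ hFL _ _ => absurd (hFL ▸ F.hL.2) hL⟩⟩⟩

end Summit.QuantumFields.YangMills.Cruxes.MinimiserStabilityRegPr.BirthV8

end
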